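import Mathlib.Analysis.SpecialFunctions.Exponential
import Mathlib.Analysis.Complex.ExponentialBounds
import Mathlib.Analysis.Calculus.Deriv.Mul
import Mathlib.MeasureTheory.Integral.IntervalIntegral.FundThmCalculus
import Mathlib.MeasureTheory.Integral.DominatedConvergence
import Mathlib.Tactic.NoncommRing
import HarnessLib

/-!
# Duhamel's formula and the derivative of the exponential map in a Banach algebra

Topic `Analysis/Calculus`; namespace `Literature.Analysis.Calculus`. Let `𝔸` be a real Banach
algebra and `exp : 𝔸 → 𝔸` the exponential (`NormedSpace.exp`). Mathlib knows that `exp` is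
analytic (`NormedSpace.exp_analytic`), hence Fréchet differentiable everywhere, but it has a
*formula* for the derivative only at `0` (`hasFDerivAt_exp_zero`), along one-parameter subgroups
(`hasDerivAt_exp_smul_const`) and in *commutative* algebras (`hasFDerivAt_exp`). This file PROVES
the classical formula for the derivative of `exp` at an arbitrary point of a non-commutative
Banach algebra (Poincaré 1899; F. Schur 1891), in Duhamel's integral form:

* `exp_sub_exp_eq_integral` — **Duhamel's formula**
  `exp y - exp x = ∫₀¹ exp ((1 - r) x) (y - x) exp (r y) dr`;
* `fderiv_exp_apply_eq_integral` — `D exp_x (h) = ∫₀¹ exp ((1 - r) x) h exp (r x) dr`;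
* `fderiv_exp_apply_eq_exp_mul_integral` — the same as
  `D exp_x (h) = exp x · ∫₀¹ exp (-r x) h exp (r x) dr = exp x · ∫₀¹ Ad(exp (-r x)) h dr`
  (for matrices `∫₀¹ Ad(e^{-rX}) dr = (1 - e^{-ad X}) / ad X`, Hall (2015), Theorem 5.4);
* `hasDerivAt_exp_comp` — along a differentiable curve `γ`:
  `(exp ∘ γ)' (t) = exp (γ t) · ∫₀¹ exp (-r γ(t)) γ'(t) exp (r γ(t)) dr` (Hall (2015), (5.11));
* elementary norm bounds used with it: `norm_exp_sub_one_le` (`‖exp a - 1‖ ≤ e^{‖a‖} - 1`, no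
  hypothesis on `‖1‖`), `norm_conj_exp_le`, `norm_conj_exp_sub_le`, and the bounds
  `norm_integral_conj_exp_le`, `norm_integral_conj_exp_sub_le` for `∫₀¹ Ad(exp (-r x)) h dr`.

Proof of the derivative formula: `r ↦ exp ((1 - r) x) exp (r y)` has derivative
`exp ((1 - r) x) (y - x) exp (r y)` (only one-parameter subgroups are differentiated), whence
Duhamel's formula by the fundamental theorem of calculus; with `y = x + ε h` the difference
quotient `ε⁻¹ (exp (x + ε h) - exp x)` equals the parametric integral
`∫₀¹ exp ((1 - r) x) h exp (r (x + ε h)) dr`, which is continuous in `ε`; so the directional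
derivative exists and equals its value at `ε = 0`, and it agrees with the Fréchet derivative
(which exists by analyticity) by uniqueness of derivatives. No power-series manipulation and no
Baker–Campbell–Hausdorff theory is used. Everything here is proved. (The tree's
`Literature.Analysis.Calculus.exp_neg_mul_fderiv_exp_mem` of `ExpLocalLieSubalgebra` proves the
consequence "`exp (-c) · D exp_c (Z)` lies in every `Ad`-stable closed subspace containing `c, Z`"
by a different route, the symmetry of second derivatives; the explicit integral formula for
`D exp_x` is what this file adds. Mathlib: no `fderiv` formula for `exp` away from `0` in the
non-commutative case, `lean search 'fderiv_exp|Duhamel'`.)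

## References

* B. C. Hall, *Lie Groups, Lie Algebras, and Representations*, 2nd ed., GTM 222 (2015), §5.4,
  Theorem 5.4 and (5.11), (5.13) [Hall2015].
* W. Rossmann, *Lie Groups: An Introduction Through Linear Groups* (2002), §1.2, Theorem 5.
-/

noncomputable section

open NormedSpace Filter Set MeasureTheory
open scoped Topology

namespace Literature.Analysis.Calculus

variable {𝔸 : Type*} [NormedRing 𝔸] [NormedAlgebra ℝ 𝔸] [NormedAlgebra ℚ 𝔸] [CompleteSpace 𝔸]

/-! ### One-parameter subgroups and Duhamel's formula -/

/-- `exp ((1 - r) x) = exp x * exp (-(r x))`. [folklore] -/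
theorem exp_one_sub_smul (x : 𝔸) (r : ℝ) : exp ((1 - r) • x) = exp x * exp (-(r • x)) := by
  rw [sub_smul, one_smul, sub_eq_add_neg]
  exact exp_add_of_commute ((Commute.refl x).smul_right r).neg_right

omit [NormedAlgebra ℚ 𝔸] in
/-- The derivative of `r ↦ exp ((1 - r) x)` is `-(exp ((1 - r) x) x)`. [folklore] -/
theorem hasDerivAt_exp_one_sub_smul (x : 𝔸) (r : ℝ) :
    HasDerivAt (fun r : ℝ => exp ((1 - r) • x)) (-(exp ((1 - r) • x) * x)) r := by
  have h1 : HasDerivAt (fun u : ℝ => exp (u • x)) (exp ((1 - r) • x) * x) (1 - r) :=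
    hasDerivAt_exp_smul_const (𝕂 := ℝ) x (1 - r)
  have h2 : HasDerivAt (fun r : ℝ => 1 - r) (-1) r := by
    simpa using (hasDerivAt_id r).const_sub (1 : ℝ)
  have h := h1.scomp r h2
  simpa [Function.comp_def] using h

/-- **Duhamel's formula** in a Banach algebra:
`exp y - exp x = ∫₀¹ exp ((1 - r) x) (y - x) exp (r y) dr`. It is the fundamental theorem of
calculus for `r ↦ exp ((1 - r) x) exp (r y)`, whose derivative is `exp ((1 - r) x) (y - x) exp (r y)`.
Hall (2015), §5.4 (proof of Theorem 5.4); Rossmann (2002), §1.2. [cite: Hall2015, §5.4] -/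
theorem exp_sub_exp_eq_integral (x y : 𝔸) :
    exp y - exp x = ∫ r in (0 : ℝ)..1, exp ((1 - r) • x) * (y - x) * exp (r • y) := by
  have hF : ∀ r : ℝ, HasDerivAt (fun r : ℝ => exp ((1 - r) • x) * exp (r • y))
      (exp ((1 - r) • x) * (y - x) * exp (r • y)) r := by
    intro r
    have h := (hasDerivAt_exp_one_sub_smul x r).fun_mul (hasDerivAt_exp_smul_const' (𝕂 := ℝ) y r)
    have heq : -(exp ((1 - r) • x) * x) * exp (r • y) + exp ((1 - r) • x) * (y * exp (r • y)) =
        exp ((1 - r) • x) * (y - x) * exp (r • y) := by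
      noncomm_ring
    rw [heq] at h
    exact h
  have hcont : Continuous fun r : ℝ => exp ((1 - r) • x) * (y - x) * exp (r • y) := by fun_prop
  rw [intervalIntegral.integral_eq_sub_of_hasDerivAt (fun r _ => hF r) (hcont.intervalIntegrable 0 1)]
  simp

/-! ### The derivative of `exp` -/

omit [NormedAlgebra ℚ 𝔸] in
/-- `exp` is Fréchet differentiable at every point (it is analytic); we write `fderiv ℝ exp x` for
its derivative. [folklore] -/
theorem hasFDerivAt_exp_fderiv (x : 𝔸) : HasFDerivAt exp (fderiv ℝ exp x) x :=
  (exp_analytic (𝕂 := ℝ) x).differentiableAt.hasFDerivAt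

/-- **The derivative of the exponential map** (Duhamel form): for `x h : 𝔸`,
`D exp_x (h) = ∫₀¹ exp ((1 - r) x) h exp (r x) dr`. Hall (2015), Theorem 5.4 with (5.13);
Rossmann (2002), §1.2, Theorem 5. [cite: Hall2015, Theorem 5.4] -/
theorem fderiv_exp_apply_eq_integral (x h : 𝔸) :
    fderiv ℝ exp x h = ∫ r in (0 : ℝ)..1, exp ((1 - r) • x) * h * exp (r • x) := by
  -- the line through `x` in direction `h`
  set ℓ : ℝ → 𝔸 := fun ε => x + ε • h with hℓ
  have hℓ' : ∀ ε, HasDerivAt ℓ h ε := fun ε => by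
    simpa [hℓ] using ((hasDerivAt_id ε).smul_const h).const_add x
  -- chain rule: the derivative of `exp ∘ ℓ` at `0` is `D exp_x (h)`
  have h1 : HasDerivAt (fun ε => exp (ℓ ε)) (fderiv ℝ exp x h) 0 := by
    have hx : ℓ 0 = x := by simp [hℓ]
    have hd : HasFDerivAt exp (fderiv ℝ exp x) (ℓ 0) := by rw [hx]; exact hasFDerivAt_exp_fderiv x
    exact hd.comp_hasDerivAt 0 (hℓ' 0)
  -- Duhamel: the difference quotient is the parametric integral `I ε`
  set I : ℝ → 𝔸 := fun ε =>
    ∫ r in (0 : ℝ)..1, exp ((1 - r) • x) * h * exp (r • (x + ε • h)) with hI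
  have hslope : ∀ ε : ℝ, ε ≠ 0 → ε⁻¹ • (exp (ℓ (0 + ε)) - exp (ℓ 0)) = I ε := by
    intro ε hε
    have hD := exp_sub_exp_eq_integral x (x + ε • h)
    simp only [hℓ, zero_add, zero_smul, add_zero]
    rw [hD]
    have hfun : (fun r : ℝ => exp ((1 - r) • x) * (x + ε • h - x) * exp (r • (x + ε • h))) =
        fun r => ε • (exp ((1 - r) • x) * h * exp (r • (x + ε • h))) := by
      funext r
      rw [add_sub_cancel_left, mul_smul_comm, smul_mul_assoc]
    rw [hfun, intervalIntegral.integral_smul, smul_smul, inv_mul_cancel₀ hε, one_smul]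
  have hIcont : Continuous I := by
    have hunc : Continuous (Function.uncurry fun (ε r : ℝ) =>
        exp ((1 - r) • x) * h * exp (r • (x + ε • h))) := by fun_prop
    exact intervalIntegral.continuous_parametric_intervalIntegral_of_continuous' hunc 0 1
  have h2 : HasDerivAt (fun ε => exp (ℓ ε)) (I 0) 0 := by
    rw [hasDerivAt_iff_tendsto_slope_zero]
    have ht : Tendsto I (𝓝[≠] (0 : ℝ)) (𝓝 (I 0)) :=
      hIcont.continuousAt.tendsto.mono_left nhdsWithin_le_nhds
    refine ht.congr' ?_
    filter_upwards [self_mem_nhdsWithin] with ε hε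
    exact (hslope ε hε).symm
  rw [h1.unique h2, hI]
  simp

/-- **The derivative of the exponential map** (adjoint form): for `x h : 𝔸`,
`D exp_x (h) = exp x · ∫₀¹ exp (-r x) h exp (r x) dr` (`= exp x · ∫₀¹ Ad(exp(-r x)) h dr`; for
matrices the operator `∫₀¹ Ad(e^{-rX}) dr` is `(1 - e^{-ad X}) / ad X`).
Hall (2015), Theorem 5.4 and (5.13). [cite: Hall2015, Theorem 5.4] -/
theorem fderiv_exp_apply_eq_exp_mul_integral (x h : 𝔸) :
    fderiv ℝ exp x h = exp x * ∫ r in (0 : ℝ)..1, exp (-(r • x)) * h * exp (r • x) := by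
  rw [fderiv_exp_apply_eq_integral]
  have hfun : (fun r : ℝ => exp ((1 - r) • x) * h * exp (r • x)) =
      fun r => exp x * (exp (-(r • x)) * h * exp (r • x)) := by
    funext r
    rw [exp_one_sub_smul]
    noncomm_ring
  have hcont : Continuous fun r : ℝ => exp (-(r • x)) * h * exp (r • x) := by fun_prop
  rw [hfun]
  exact ((ContinuousLinearMap.mul ℝ 𝔸) (exp x)).intervalIntegral_comp_comm
    (hcont.intervalIntegrable 0 1)

/-- **The derivative of `exp` along a curve**: if `γ` has derivative `γ'` at `t`, then
`s ↦ exp (γ s)` has derivative `exp (γ t) · ∫₀¹ exp (-r γ(t)) γ' exp (r γ(t)) dr` at `t`.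
Hall (2015), Theorem 5.4, formula (5.11). [cite: Hall2015, Theorem 5.4] -/
theorem hasDerivAt_exp_comp {γ : ℝ → 𝔸} {γ' : 𝔸} {t : ℝ} (hγ : HasDerivAt γ γ' t) :
    HasDerivAt (fun s => exp (γ s))
      (exp (γ t) * ∫ r in (0 : ℝ)..1, exp (-(r • γ t)) * γ' * exp (r • γ t)) t := by
  have h := (hasFDerivAt_exp_fderiv (γ t)).comp_hasDerivAt t hγ
  rwa [Function.comp_def, fderiv_exp_apply_eq_exp_mul_integral] at h

/-! ### Norm bounds -/

omit [NormedAlgebra ℚ 𝔸] [CompleteSpace 𝔸] in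
/-- Termwise bound for the exponential series: `‖a^n / n!‖ ≤ ‖a‖^n / n!` for `n ≥ 1` (no
hypothesis on `‖1‖`). [folklore] -/
theorem norm_expSeries_term_le (a : 𝔸) {n : ℕ} (hn : 0 < n) :
    ‖((n.factorial : ℝ)⁻¹) • a ^ n‖ ≤ ‖a‖ ^ n / n.factorial := by
  rw [norm_smul, norm_inv, RCLike.norm_natCast, div_eq_inv_mul]
  gcongr
  exact norm_pow_le' a hn

omit [NormedAlgebra ℚ 𝔸] in
/-- `‖exp a - 1‖ ≤ e^{‖a‖} - 1` in any Banach algebra (termwise comparison of `Σ_{n ≥ 1} aⁿ/n!`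
with the real series; no hypothesis on `‖1‖`). [folklore] -/
theorem norm_exp_sub_one_le (a : 𝔸) : ‖exp a - 1‖ ≤ Real.exp ‖a‖ - 1 := by
  have h1 : HasSum (fun n : ℕ => ((n.factorial : ℝ)⁻¹) • a ^ n) (exp a) :=
    exp_series_hasSum_exp' (𝕂 := ℝ) a
  have h1' : HasSum (fun n : ℕ => (((n + 1).factorial : ℝ)⁻¹) • a ^ (n + 1)) (exp a - 1) := by
    have h := (hasSum_nat_add_iff' 1).mpr h1
    simpa using h
  have h2 : HasSum (fun n : ℕ => ‖a‖ ^ n / (n.factorial : ℝ)) (Real.exp ‖a‖) := by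
    rw [Real.exp_eq_exp_ℝ]
    exact expSeries_div_hasSum_exp ‖a‖
  have h2' : HasSum (fun n : ℕ => ‖a‖ ^ (n + 1) / ((n + 1).factorial : ℝ)) (Real.exp ‖a‖ - 1) := by
    have h := (hasSum_nat_add_iff' 1).mpr h2
    simpa using h
  exact h1'.norm_le_of_bounded h2' fun n => norm_expSeries_term_le a n.succ_pos

omit [NormedAlgebra ℚ 𝔸] in
/-- `‖exp (r x) - 1‖ ≤ e^{‖x‖} - 1` for `|r| ≤ 1`. [folklore] -/
theorem norm_exp_smul_sub_one_le (x : 𝔸) {r : ℝ} (hr : |r| ≤ 1) :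
    ‖exp (r • x) - 1‖ ≤ Real.exp ‖x‖ - 1 := by
  refine (norm_exp_sub_one_le (r • x)).trans ?_
  gcongr
  calc ‖r • x‖ = |r| * ‖x‖ := by rw [norm_smul, Real.norm_eq_abs]
    _ ≤ 1 * ‖x‖ := by gcongr
    _ = ‖x‖ := one_mul _

omit [NormedAlgebra ℝ 𝔸] [NormedAlgebra ℚ 𝔸] [CompleteSpace 𝔸] in
/-- `‖(1 + u) h (1 + v)‖`-type bound: `‖a h b‖ ≤ (1 + ‖a - 1‖) ‖h‖ (1 + ‖b - 1‖)` (no hypothesis on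
`‖1‖`). [folklore] -/
theorem norm_mul_mul_le_of_sub_one (a h b : 𝔸) :
    ‖a * h * b‖ ≤ (1 + ‖a - 1‖) * ‖h‖ * (1 + ‖b - 1‖) := by
  have key : a * h * b = h + (a - 1) * h + h * (b - 1) + (a - 1) * h * (b - 1) := by noncomm_ring
  rw [key]
  have e1 : ‖(a - 1) * h‖ ≤ ‖a - 1‖ * ‖h‖ := norm_mul_le _ _
  have e2 : ‖h * (b - 1)‖ ≤ ‖h‖ * ‖b - 1‖ := norm_mul_le _ _
  have e3 : ‖(a - 1) * h * (b - 1)‖ ≤ ‖a - 1‖ * ‖h‖ * ‖b - 1‖ :=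
    (norm_mul_le _ _).trans (mul_le_mul_of_nonneg_right (norm_mul_le _ _) (norm_nonneg _))
  calc ‖h + (a - 1) * h + h * (b - 1) + (a - 1) * h * (b - 1)‖
      ≤ ‖h‖ + ‖(a - 1) * h‖ + ‖h * (b - 1)‖ + ‖(a - 1) * h * (b - 1)‖ := norm_add₄_le
    _ ≤ ‖h‖ + ‖a - 1‖ * ‖h‖ + ‖h‖ * ‖b - 1‖ + ‖a - 1‖ * ‖h‖ * ‖b - 1‖ := by gcongr
    _ = (1 + ‖a - 1‖) * ‖h‖ * (1 + ‖b - 1‖) := by ring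

omit [NormedAlgebra ℝ 𝔸] [NormedAlgebra ℚ 𝔸] [CompleteSpace 𝔸] in
/-- `‖a h b - h‖ ≤ ((1 + ‖a - 1‖)(1 + ‖b - 1‖) - 1) ‖h‖`. [folklore] -/
theorem norm_mul_mul_sub_le_of_sub_one (a h b : 𝔸) :
    ‖a * h * b - h‖ ≤ ((1 + ‖a - 1‖) * (1 + ‖b - 1‖) - 1) * ‖h‖ := by
  have key : a * h * b - h = (a - 1) * h + h * (b - 1) + (a - 1) * h * (b - 1) := by noncomm_ring
  rw [key]
  have e1 : ‖(a - 1) * h‖ ≤ ‖a - 1‖ * ‖h‖ := norm_mul_le _ _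
  have e2 : ‖h * (b - 1)‖ ≤ ‖h‖ * ‖b - 1‖ := norm_mul_le _ _
  have e3 : ‖(a - 1) * h * (b - 1)‖ ≤ ‖a - 1‖ * ‖h‖ * ‖b - 1‖ :=
    (norm_mul_le _ _).trans (mul_le_mul_of_nonneg_right (norm_mul_le _ _) (norm_nonneg _))
  calc ‖(a - 1) * h + h * (b - 1) + (a - 1) * h * (b - 1)‖
      ≤ ‖(a - 1) * h‖ + ‖h * (b - 1)‖ + ‖(a - 1) * h * (b - 1)‖ := norm_add₃_le
    _ ≤ ‖a - 1‖ * ‖h‖ + ‖h‖ * ‖b - 1‖ + ‖a - 1‖ * ‖h‖ * ‖b - 1‖ := by gcongr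
    _ = ((1 + ‖a - 1‖) * (1 + ‖b - 1‖) - 1) * ‖h‖ := by ring

omit [NormedAlgebra ℚ 𝔸] in
/-- `‖exp (-r x) h exp (r x)‖ ≤ e^{2‖x‖} ‖h‖` for `|r| ≤ 1`. [folklore] -/
theorem norm_conj_exp_le (x h : 𝔸) {r : ℝ} (hr : |r| ≤ 1) :
    ‖exp (-(r • x)) * h * exp (r • x)‖ ≤ Real.exp (2 * ‖x‖) * ‖h‖ := by
  have ha : ‖exp (-(r • x)) - 1‖ ≤ Real.exp ‖x‖ - 1 := by
    rw [← neg_smul]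
    exact norm_exp_smul_sub_one_le x (by simpa using hr)
  have hb : ‖exp (r • x) - 1‖ ≤ Real.exp ‖x‖ - 1 := norm_exp_smul_sub_one_le x hr
  have ha' : 1 + ‖exp (-(r • x)) - 1‖ ≤ Real.exp ‖x‖ := by linarith
  have hb' : 1 + ‖exp (r • x) - 1‖ ≤ Real.exp ‖x‖ := by linarith
  have h2 : Real.exp (2 * ‖x‖) = Real.exp ‖x‖ * Real.exp ‖x‖ := by rw [two_mul, Real.exp_add]
  calc ‖exp (-(r • x)) * h * exp (r • x)‖
      ≤ (1 + ‖exp (-(r • x)) - 1‖) * ‖h‖ * (1 + ‖exp (r • x) - 1‖) :=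
        norm_mul_mul_le_of_sub_one _ _ _
    _ ≤ Real.exp ‖x‖ * ‖h‖ * Real.exp ‖x‖ := by gcongr
    _ = Real.exp (2 * ‖x‖) * ‖h‖ := by rw [h2]; ring

omit [NormedAlgebra ℚ 𝔸] in
/-- `‖exp (-r x) h exp (r x) - h‖ ≤ (e^{2‖x‖} - 1) ‖h‖` for `|r| ≤ 1`. [folklore] -/
theorem norm_conj_exp_sub_le (x h : 𝔸) {r : ℝ} (hr : |r| ≤ 1) :
    ‖exp (-(r • x)) * h * exp (r • x) - h‖ ≤ (Real.exp (2 * ‖x‖) - 1) * ‖h‖ := by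
  have ha : ‖exp (-(r • x)) - 1‖ ≤ Real.exp ‖x‖ - 1 := by
    rw [← neg_smul]
    exact norm_exp_smul_sub_one_le x (by simpa using hr)
  have hb : ‖exp (r • x) - 1‖ ≤ Real.exp ‖x‖ - 1 := norm_exp_smul_sub_one_le x hr
  have ha' : 1 + ‖exp (-(r • x)) - 1‖ ≤ Real.exp ‖x‖ := by linarith
  have hb' : 1 + ‖exp (r • x) - 1‖ ≤ Real.exp ‖x‖ := by linarith
  have ha0 : 0 ≤ 1 + ‖exp (-(r • x)) - 1‖ := by positivity
  have hb0 : 0 ≤ 1 + ‖exp (r • x) - 1‖ := by positivity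
  have hprod : (1 + ‖exp (-(r • x)) - 1‖) * (1 + ‖exp (r • x) - 1‖) ≤
      Real.exp ‖x‖ * Real.exp ‖x‖ :=
    mul_le_mul ha' hb' hb0 (Real.exp_pos _).le
  have h2 : Real.exp (2 * ‖x‖) = Real.exp ‖x‖ * Real.exp ‖x‖ := by rw [two_mul, Real.exp_add]
  calc ‖exp (-(r • x)) * h * exp (r • x) - h‖
      ≤ ((1 + ‖exp (-(r • x)) - 1‖) * (1 + ‖exp (r • x) - 1‖) - 1) * ‖h‖ :=
        norm_mul_mul_sub_le_of_sub_one _ _ _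
    _ ≤ (Real.exp ‖x‖ * Real.exp ‖x‖ - 1) * ‖h‖ := by gcongr
    _ = (Real.exp (2 * ‖x‖) - 1) * ‖h‖ := by rw [h2]

omit [NormedAlgebra ℚ 𝔸] in
/-- `‖exp (-r x) h exp (r x) - h‖ ≤ 15 ‖x‖ ‖h‖` for `|r| ≤ 1` and `‖x‖ ≤ 1`
(`e^{2u} - 1 ≤ 2u e^{2u} ≤ 2e² u < 15 u`). [folklore] -/
theorem norm_conj_exp_sub_le_mul (x h : 𝔸) {r : ℝ} (hr : |r| ≤ 1) (hx : ‖x‖ ≤ 1) :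
    ‖exp (-(r • x)) * h * exp (r • x) - h‖ ≤ 15 * ‖x‖ * ‖h‖ := by
  refine (norm_conj_exp_sub_le x h hr).trans ?_
  -- `e^u - 1 ≤ u e^u`, from `1 - u ≤ e^{-u}`
  have h1 : Real.exp (2 * ‖x‖) - 1 ≤ 2 * ‖x‖ * Real.exp (2 * ‖x‖) := by
    have h := Real.add_one_le_exp (-(2 * ‖x‖))
    have hpos := Real.exp_pos (2 * ‖x‖)
    have hprod : Real.exp (-(2 * ‖x‖)) * Real.exp (2 * ‖x‖) = 1 := by
      rw [← Real.exp_add, neg_add_cancel, Real.exp_zero]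
    nlinarith [mul_le_mul_of_nonneg_right h hpos.le]
  have h2 : Real.exp (2 * ‖x‖) ≤ Real.exp 2 := Real.exp_le_exp.mpr (by linarith)
  have h3 : Real.exp 2 < 7.5 := by
    have := Real.exp_one_lt_d9
    have h : Real.exp 2 = Real.exp 1 * Real.exp 1 := by rw [← Real.exp_add]; norm_num
    rw [h]; nlinarith [Real.exp_pos 1]
  have h4 : Real.exp (2 * ‖x‖) - 1 ≤ 15 * ‖x‖ := by
    calc Real.exp (2 * ‖x‖) - 1 ≤ 2 * ‖x‖ * Real.exp (2 * ‖x‖) := h1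
      _ ≤ 2 * ‖x‖ * 7.5 := by gcongr; exact h2.trans h3.le
      _ = 15 * ‖x‖ := by ring
  exact mul_le_mul_of_nonneg_right h4 (norm_nonneg _)

omit [NormedAlgebra ℚ 𝔸] in
/-- The integral `∫₀¹ exp (-r x) h exp (r x) dr` is bounded by `e^{2‖x‖} ‖h‖`. [folklore] -/
theorem norm_integral_conj_exp_le (x h : 𝔸) :
    ‖∫ r in (0 : ℝ)..1, exp (-(r • x)) * h * exp (r • x)‖ ≤ Real.exp (2 * ‖x‖) * ‖h‖ := by
  have h := intervalIntegral.norm_integral_le_of_norm_le_const (a := (0 : ℝ)) (b := 1)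
    (C := Real.exp (2 * ‖x‖) * ‖h‖) (f := fun r : ℝ => exp (-(r • x)) * h * exp (r • x)) ?_
  · simpa using h
  · intro r hr
    rw [uIoc_of_le zero_le_one] at hr
    exact norm_conj_exp_le x h (by rw [abs_of_pos hr.1]; exact hr.2)

/-- `‖∫₀¹ exp (-r x) h exp (r x) dr - h‖ ≤ 15 ‖x‖ ‖h‖` for `‖x‖ ≤ 1`. [folklore] -/
theorem norm_integral_conj_exp_sub_le (x h : 𝔸) (hx : ‖x‖ ≤ 1) :
    ‖(∫ r in (0 : ℝ)..1, exp (-(r • x)) * h * exp (r • x)) - h‖ ≤ 15 * ‖x‖ * ‖h‖ := by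
  have hcont : Continuous fun r : ℝ => exp (-(r • x)) * h * exp (r • x) := by fun_prop
  have hsub : (∫ r in (0 : ℝ)..1, exp (-(r • x)) * h * exp (r • x)) - h =
      ∫ r in (0 : ℝ)..1, (exp (-(r • x)) * h * exp (r • x) - h) := by
    rw [intervalIntegral.integral_sub (hcont.intervalIntegrable 0 1) intervalIntegrable_const]
    simp
  rw [hsub]
  have h := intervalIntegral.norm_integral_le_of_norm_le_const (a := (0 : ℝ)) (b := 1)
    (C := 15 * ‖x‖ * ‖h‖) (f := fun r : ℝ => exp (-(r • x)) * h * exp (r • x) - h) ?_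
  · simpa using h
  · intro r hr
    rw [uIoc_of_le zero_le_one] at hr
    exact norm_conj_exp_sub_le_mul x h (by rw [abs_of_pos hr.1]; exact hr.2) hx

end Literature.Analysis.Calculus
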